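import Mathlib
import Summits.AtomisticToContinuum.Crystallization.Theses.PhononSlackCertificates
import Summits.AtomisticToContinuum.Crystallization.Theorems.PhononSlackCertificatesNearFieldConvexityCoarseRegime
import Summits.AtomisticToContinuum.Crystallization.Theorems.PhononSlackCertificatesNearFieldConvexityStubChartCoverage
import Summits.AtomisticToContinuum.Crystallization.Theorems.PhononSlackCertificatesNearFieldConvexityStubChartSites
import Summits.AtomisticToContinuum.Crystallization.Theorems.NashClassCertificatesNashNearFieldStubChartCoreAssemblyWeak
import Summits.AtomisticToContinuum.Crystallization.Theorems.NashClassCertificatesNashNearFieldStubLabelledPlacement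

/-!
# Route `PhononSlackCertificates`, crux `NearFieldConvexity` (stmt-AtomisticToContinuum-13958), line `Sketch`:
the `2/5`-CHART HYPOTHESIS of the energy stubs is DISCHARGEABLE (piece R2 of the stub `stub_thresholdSqPaid`)

The two registered energy stubs of skeleton v22 (`stub_thresholdSqPaid`, perturbative; `stub_roughSitesPaid`,
non-perturbative) carry, besides `ε₁`-goodness of `Ω` (`ε₁ ≤ 1/20`), the hypothesis that every radius-3 interior site
`i` of `Ω` has a `2/5`-CHART: a linear isometry `A`, a box cell `(a, h)` (`47/50 ≤ a ≤ 1`, `39a/50 ≤ h ≤ 17a/20`) and a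
Hägg word `s` such that the 2-ball of `x i` is two-way `2/5`-matched with the Barlow template
`x i + A {u • u(a) + v • v(a) + L_m • w(a) + m • h e₃}`.  This hypothesis is now a THEOREM:

* goodness is monotone in the tolerance (`IsTwoShellGood.mono`), so an `ε`-good set, `ε ≤ 1/20`, is `1/20`-good;
* the lead's assembly `chart_of_stubs_radius` (`…NearFieldConvexityCoarseRegime`) builds the chart at every interior
  site of radius `ρ ≥ 3` of a `1/20`-good set from the landed chart coverage (`stub_chartCoverage`), the chart core and
  the landed site lemma (`stub_chartSites`);
* the chart core is the twin crux's landed labelled placement (`NashClassCertificatesNashNearField.stub_labelledPlacement`,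
  a certified finite tree search) through its landed weak assembly
  (`NashClassCertificatesNashNearField.stub_chartCore_of_labelled_placement`).

So `stub_chartsOfGood` discharges the chart hypothesis verbatim (apply it as `stub_chartsOfGood ε₁ hε₁ N x Ω hΩ` wherever an
energy stub asks for the charts of an `ε₁`-good set `Ω`).  `[folklore]`.
-/

noncomputable section

open scoped BigOperators
open Literature.MathematicalPhysics.StatisticalMechanics Literature.Geometry.DiscreteGeometry

namespace Summit.AtomisticToContinuum.Crystallization.Theorems.PhononSlackNearFieldConvexity

/-- **Registered piece `stub_chartsOfGood` (R2 of `stub_thresholdSqPaid`): the `2/5`-chart hypothesis of the energy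
stubs is dischargeable.**  For every `ε ≤ 1/20`, every configuration `x`, every finite set `Ω` of `ε`-good particles
and every radius-3 interior site `i ∈ Ω` there are a linear isometry `A`, a box cell `(a, h)` and a Hägg word `s`
such that the 2-ball of `x i` is two-way `2/5`-matched with `x i + A {u • u(a) + v • v(a) + L_m • w(a) + m • h e₃}`
(`IsTwoShellGood.mono`, then `chart_of_stubs_radius` fed with `stub_chartCoverage`, the twin's chart core
`stub_chartCore_of_labelled_placement stub_labelledPlacement`, and `stub_chartSites`). [folklore] -/
theorem stub_chartsOfGood : ∀ (ε : ℝ), ε ≤ 1 / 20 → ∀ (N : ℕ) (x : Fin N → EuclideanSpace ℝ (Fin 3)) (Ω : Finset (Fin N)), (∀ i ∈ Ω, IsTwoShellGood ε (47 / 50) 1 x i) → ∀ i ∈ Ω, (∀ k : Fin N, dist (x k) (x i) ≤ 3 → k ∈ Ω) → (∃ (A : EuclideanSpace ℝ (Fin 3) →ₗᵢ[ℝ] EuclideanSpace ℝ (Fin 3)) (a h : ℝ) (s : ℤ → ℤ), 47 / 50 ≤ a ∧ a ≤ 1 ∧ 39 / 50 * a ≤ h ∧ h ≤ 17 / 20 *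 a ∧ IsHaggSeq s ∧ (fun S : Set (EuclideanSpace ℝ (Fin 3)) => (∀ j : Fin N, dist (x j) (x i) ≤ 2 → ∃ p ∈ S, dist (x j) p ≤ 2 / 5) ∧ (∀ p ∈ S, dist p (x i) ≤ 2 → ∃ j : Fin N, dist (x j) p ≤ 2 / 5)) {p | ∃ m u v : ℤ, p = x i + A (((u : ℝ) • triangularVec₁ a) + ((v : ℝ) • triangularVec₂ a) + ((haggLabel s m : ℝ) • barlowOffset a) + ((m : ℝ) • layerNormal h))}) := by
  intro ε hε N x Ω hΩ i hi hint
  exact chart_of_stubs_radius le_rfl stub_chartCoverage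
    (Summit.AtomisticToContinuum.Crystallization.Theorems.NashClassCertificatesNashNearField.stub_chartCore_of_labelled_placement
      Summit.AtomisticToContinuum.Crystallization.Theorems.NashClassCertificatesNashNearField.stub_labelledPlacement)
    stub_chartSites N x Ω (fun k hk => (hΩ k hk).mono hε (by norm_num)) i hi hint

end Summit.AtomisticToContinuum.Crystallization.Theorems.PhononSlackNearFieldConvexity
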